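import Summits.QuantumFields.YangMills.Theorems.ForcedResponseSkewnessResponseLocalisationSymNearCovOfCentredOsc
import HarnessLib

/-!
# Route `ForcedResponseSkewness`, crux `ResponseLocalisation` (rev 6, stmt-QuantumFields-26871), line «signed-femto-collar»:
# the centred oscillation law `CentredOscLaw` only needs the engine's OWN radii (a covering set of cube sizes)

Helper file (`--supports stmt-QuantumFields-26871`) of the lead prover `ym-line-frs-p1` (g5); companion of
`…SymNearCovOfCentredOsc.lean` / `…CentredOscToolkit.lean`.  The registered AF stub of skeleton v3 is
`stub_centredOsc : CentredOscLawSigR` — the reference-free two-exterior oscillation law for the signed radial covariance sum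
at the centre of EVERY centred femto cube `[-N, N]⁴`.  A multi-scale expansion works on its own cube sizes (radii `N_k`, e.g.
`L^k M`); for the one-point boundary law the tree transports such sparse-radius statements by antitonicity under nesting
(`BoundaryLaw.fbl_of_oscillation_cover`), which is NOT available for covariances (a big-cube covariance is not an average of
sub-cube covariances).  The law of total covariance replaces it, at the price of the covariance of the sub-cube kernel MEANS
— second order in the frozen-boundary law `FBL` and absorbed, exactly as in `symNearCovLaw_of_centredOsc`, by the cut
`R ≤ t·d₀` chosen after `κ, d₀` and by `a β → 0`:

* `centredOscLaw_of_cover` — for a unit map `0 < a β → 0` with `FBL G r a`, a set of radii `S` covering every radius from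
  `D₀` on up to a factor `θ ≥ 1` (`∀ D ≥ D₀ ∃ N ∈ S, N+1 ≤ D ≤ θ (N+1)`), the centred oscillation law asked ONLY for radii in
  `S` implies `CentredOscLaw G r a` (all radii; femto scale `min ℓ₂ ℓ₁`);
* `symNearCovLaw_of_centredOsc_cover` — hence (with `symNearCovLaw_of_centredOsc`) the AF stub statement `SymNearCovLaw G r a`.

So the route's AF engine target E-sym (`Cruxes/ResponseLocalisation/Lines/signed-femto-collar-engine.md`) may be delivered on
the engine's geometric sequence of cubes, like the spine's E1.  No summit is proved by any of this (leaf R2a `BalabanLadder.NT`,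
conditional rung line; the oscillation law, the crux, NT and the YM mass gap are NOT proved).
-/

set_option autoImplicit false

noncomputable section

open MeasureTheory Filter Topology
open Literature.MathematicalPhysics.QuantumFieldTheory Literature.MathematicalPhysics.QuantumLattice
open Literature.Probability.LatticeModels
open Summit.QuantumFields.YangMills.Cruxes.OSLegsFromFemtoAndGap.DlrCollarTransfer
open Summit.QuantumFields.YangMills.Cruxes.NT.BoundaryLaw
open Summit.QuantumFields.YangMills.Cruxes.ResponseLocalisation.Birth

namespace Summit.QuantumFields.YangMills.Cruxes.ResponseLocalisation.CentredOsc

/-! ## Arithmetic -/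

/-- The bookkeeping of the cover transport: with `M = N'+1` the target radius (+1), `1 ≤ θ`, `t ≤ 1/2`,
`t ≤ κ/(20736 θ⁴ (C₁²+1))` and `X ≤ 3 t M/θ`, twice the second-order remainder plus twice the oscillation `κ/(4θ⁴)/(M/θ)⁴` is at
most `κ/M⁴`. [folklore] -/
theorem cover_bookkeeping {κ C₁ θ t M X : ℝ} (hκ : 0 < κ) (hθ : 1 ≤ θ) (ht0 : 0 < t) (ht1 : t ≤ 1 / 2)
    (htκ : t ≤ κ / (20736 * θ ^ 4 * (C₁ ^ 2 + 1))) (hM : 0 < M) (hX0 : 0 ≤ X) (hX : X ≤ 3 * t * M / θ) :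
    2 * (X ^ 4 * (4 * (C₁ / (M / (2 * θ)) ^ 4) * (C₁ / (M / θ) ^ 4))) + 2 * (κ / (4 * θ ^ 4) / (M / θ) ^ 4) ≤
      κ / M ^ 4 := by
  have hθ0 : 0 < θ := by linarith
  have hM4 : 0 < M ^ 4 := by positivity
  have hθ4 : 0 < θ ^ 4 := by positivity
  have e1 : C₁ / (M / (2 * θ)) ^ 4 = 16 * θ ^ 4 * C₁ / M ^ 4 := by field_simp; ring
  have e2 : C₁ / (M / θ) ^ 4 = θ ^ 4 * C₁ / M ^ 4 := by field_simp
  have e3 : κ / (4 * θ ^ 4) / (M / θ) ^ 4 = κ / 4 / M ^ 4 := by field_simp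
  rw [e1, e2, e3]
  have hXθ : X * θ ≤ 3 * t * M := by
    have := mul_le_mul_of_nonneg_right hX hθ0.le
    rwa [div_mul_cancel₀ _ hθ0.ne'] at this
  have hX4 : (X * θ) ^ 4 ≤ (3 * t * M) ^ 4 := pow_le_pow_left₀ (by positivity) hXθ 4
  have ht4 : t ^ 4 ≤ t * (1 / 8) := by
    have ht3 : t ^ 3 ≤ (1 / 2) ^ 3 := pow_le_pow_left₀ ht0.le ht1 3
    nlinarith
  have hC : θ ^ 4 * (C₁ ^ 2 * t) ≤ κ / 20736 := by
    have h1 : θ ^ 4 * (C₁ ^ 2 * t) ≤ θ ^ 4 * ((C₁ ^ 2 + 1) * t) := by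
      apply mul_le_mul_of_nonneg_left _ hθ4.le; nlinarith
    have h2 : θ ^ 4 * ((C₁ ^ 2 + 1) * t) ≤ θ ^ 4 * ((C₁ ^ 2 + 1) * (κ / (20736 * θ ^ 4 * (C₁ ^ 2 + 1)))) := by
      apply mul_le_mul_of_nonneg_left _ hθ4.le
      exact mul_le_mul_of_nonneg_left htκ (by positivity)
    have h3 : θ ^ 4 * ((C₁ ^ 2 + 1) * (κ / (20736 * θ ^ 4 * (C₁ ^ 2 + 1)))) = κ / 20736 := by
      field_simp
    linarith
  -- the remainder: `2·X⁴·4·(16θ⁴C₁/M⁴)(θ⁴C₁/M⁴) = 128 C₁² θ⁸ X⁴ / M⁸ ≤ κ/8/M⁴`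
  have hrem : 2 * (X ^ 4 * (4 * (16 * θ ^ 4 * C₁ / M ^ 4) * (θ ^ 4 * C₁ / M ^ 4))) ≤ κ / 8 / M ^ 4 := by
    have key : 2 * (X ^ 4 * (4 * (16 * θ ^ 4 * C₁ / M ^ 4) * (θ ^ 4 * C₁ / M ^ 4))) =
        128 * C₁ ^ 2 * θ ^ 4 * (X * θ) ^ 4 / M ^ 4 / M ^ 4 := by
      field_simp
      ring
    rw [key, div_le_div_iff_of_pos_right hM4, div_le_iff₀ hM4]
    calc 128 * C₁ ^ 2 * θ ^ 4 * (X * θ) ^ 4 ≤ 128 * C₁ ^ 2 * θ ^ 4 * (3 * t * M) ^ 4 := by gcongr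
      _ = 10368 * (θ ^ 4 * (C₁ ^ 2 * t ^ 4)) * M ^ 4 := by ring
      _ ≤ 10368 * (θ ^ 4 * (C₁ ^ 2 * (t * (1 / 8)))) * M ^ 4 := by gcongr
      _ = 1296 * (θ ^ 4 * (C₁ ^ 2 * t)) * M ^ 4 := by ring
      _ ≤ 1296 * (κ / 20736) * M ^ 4 := by gcongr
      _ ≤ κ / 8 * M ^ 4 := by nlinarith [hM4]
  have hosc : 2 * (κ / 4 / M ^ 4) = κ / 2 / M ^ 4 := by ring
  rw [hosc]
  have hsum : κ / 8 / M ^ 4 + κ / 2 / M ^ 4 ≤ κ / M ^ 4 := by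
    rw [← add_div, div_le_div_iff_of_pos_right hM4]; linarith
  linarith

/-! ## The cover transport -/

section Cover

variable (G : Type) [Group G] [TopologicalSpace G] [IsTopologicalGroup G] [CompactSpace G]
  [MeasurableSpace G] [BorelSpace G] (r : LatticeRep G)

/-- **`CentredOscLaw` from the oscillation law on a covering set of radii.**  For a unit map `0 < a β → 0` with `FBL G r a`
and a set `S ⊆ ℕ` covering every radius `D ≥ D₀` up to the factor `θ ≥ 1` (`∃ N ∈ S, N+1 ≤ D ≤ θ·(N+1)`): if the centred
reference-free two-exterior oscillation law holds for the radii IN `S`, it holds for ALL radii (femto scale `min ℓ₂ ℓ₁`).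
Proof: for the cube `[-N',N']⁴` pick the cover radius `N ∈ S` of `N'+1`; the law of total covariance through `[-N,N]⁴` for each
of the two exteriors (`abs_wsum_kerCov_sub_kerE_le`, reference values `0`) leaves two averages of the same inner sum, each
within the inner oscillation of a fixed value, plus two remainders second order in `FBL` (`cover_bookkeeping`). [folklore] -/
theorem centredOscLaw_of_cover (a : ℝ → ℝ) (ha : ∀ β, 0 < a β) (hlim : Tendsto a atTop (𝓝 0)) (hFBL : FBL G r a)
    (S : Set ℕ) (θ : ℝ) (hθ : 1 ≤ θ) (D₀ : ℕ)
    (hcover : ∀ D : ℕ, D₀ ≤ D → ∃ N ∈ S, N + 1 ≤ D ∧ (D : ℝ) ≤ θ * ((N : ℝ) + 1))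
    (hosc : ∃ ℓ₂ : ℝ, 0 < ℓ₂ ∧ ∀ κ : ℝ, 0 < κ → ∀ d₀ : ℝ, 0 < d₀ → d₀ ≤ ℓ₂ →
      ∃ R : ℝ, 0 < R ∧ R ≤ d₀ ∧ ∃ β₂ : ℝ, ∀ β : ℝ, β₂ ≤ β → ∀ N ∈ S, ((2 * N + 1 : ℕ) : ℝ) * a β ≤ ℓ₂ →
        R / a β + 2 ≤ (N : ℝ) + 1 → d₀ ≤ a β * ((N : ℝ) + 1) →
        ∀ (η η' : LGConfig 4 G) (B : Finset (Fin 4 → ℤ)),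
          (∀ w : Fin 4 → ℤ, a β * ‖siteToE w‖ < R → w ∈ B) →
          ∀ φ : ℝ → ℝ, (∀ t, |φ t| ≤ 1) → (∀ t, R ≤ t → φ t = 0) →
            |∑ w ∈ B, φ (a β * ‖siteToE w‖) *
                (kerCov G r β (fun _ => -(N : ℤ)) (2 * N + 1) η (dens G r w) (dens G r 0) -
                  kerCov G r β (fun _ => -(N : ℤ)) (2 * N + 1) η' (dens G r w) (dens G r 0))| ≤
              κ / ((N : ℝ) + 1) ^ 4) :
    CentredOscLaw G r a := by
  obtain ⟨ℓ₂, hℓ₂, H⟩ := hosc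
  obtain ⟨C₁, β₁, ℓ₁, p, hℓ₁, hC₁, hF⟩ := hFBL
  have hθ0 : 0 < θ := by linarith
  refine ⟨min ℓ₂ ℓ₁, lt_min hℓ₂ hℓ₁, fun κ hκ d₀ hd₀ hd₀ℓ => ?_⟩
  -- the smallness parameter `t`, the inner data, the thresholds
  set t : ℝ := min (1 / 2) (κ / (20736 * θ ^ 4 * (C₁ ^ 2 + 1))) with ht_def
  have ht0 : 0 < t := lt_min (by norm_num) (by positivity)
  have ht1 : t ≤ 1 / 2 := min_le_left _ _
  have htκ : t ≤ κ / (20736 * θ ^ 4 * (C₁ ^ 2 + 1)) := min_le_right _ _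
  have htθ : t / θ ≤ 1 := by
    rw [div_le_one hθ0]; linarith
  have htd₀ : t * d₀ / θ ≤ d₀ := by
    have e : t * d₀ / θ = (t / θ) * d₀ := by ring
    have h1 := mul_le_mul_of_nonneg_right htθ hd₀.le
    rw [e]; linarith only [h1]
  obtain ⟨R, hR0, hRle, β₂, HR⟩ := H (κ / (4 * θ ^ 4)) (by positivity) (t * d₀ / θ) (by positivity)
    (htd₀.trans (hd₀ℓ.trans (min_le_left _ _)))
  obtain ⟨βa, hβa⟩ : ∃ βa : ℝ, ∀ β, βa ≤ β → a β ≤ t * d₀ / (4 * θ) ∧ a β ≤ d₀ / ((D₀ : ℝ) + 1) := by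
    have hev : ∀ᶠ β in atTop, a β < min (t * d₀ / (4 * θ)) (d₀ / ((D₀ : ℝ) + 1)) :=
      (tendsto_order.1 hlim).2 _ (lt_min (by positivity) (by positivity))
    obtain ⟨βa, hβa⟩ := eventually_atTop.1 hev
    exact ⟨βa, fun β hβ => ⟨((hβa β hβ).trans_le (min_le_left _ _)).le,
      ((hβa β hβ).trans_le (min_le_right _ _)).le⟩⟩
  refine ⟨R, hR0, hRle.trans htd₀, max (max β₂ β₁) βa, ?_⟩
  intro β hβ N' hside hdR hdd η η' B hB φ hφ1 hφR
  have hβ₂ : β₂ ≤ β := le_trans (le_trans (le_max_left _ _) (le_max_left _ _)) hβ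
  have hβ₁ : β₁ ≤ β := le_trans (le_trans (le_max_right _ _) (le_max_left _ _)) hβ
  obtain ⟨haβt, haβD⟩ := hβa β (le_trans (le_max_right _ _) hβ)
  have haβ : 0 < a β := ha β
  set ω : (Fin 4 → ℤ) → ℝ := fun w => φ (a β * ‖siteToE w‖) with hω_def
  -- the target radius `M = N'+1` and the cover radius `N ∈ S`, `m = N+1`
  set M : ℝ := (N' : ℝ) + 1 with hM_def
  have hM0 : 0 < M := by positivity
  have hd₀M : d₀ / a β ≤ M := by
    rw [div_le_iff₀ haβ]
    have e : M * a β = a β * M := mul_comm _ _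
    linarith only [hdd, e]
  have hD₀ : D₀ ≤ N' + 1 := by
    have h1 : (D₀ : ℝ) + 1 ≤ d₀ / a β := by
      rw [le_div_iff₀ haβ]
      have h5 := (le_div_iff₀ (by positivity : (0 : ℝ) < (D₀ : ℝ) + 1)).1 haβD
      linarith only [h5]
    have h6 := h1.trans hd₀M
    have h2 : (D₀ : ℝ) ≤ (N' : ℝ) + 1 := by
      have e : M = (N' : ℝ) + 1 := hM_def
      linarith only [h6, e]
    exact_mod_cast h2
  obtain ⟨N, hNS, hNle, hθN⟩ := hcover (N' + 1) hD₀
  push_cast at hθN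
  set m : ℝ := (N : ℝ) + 1 with hm_def
  have hm0 : 0 < m := by positivity
  have hmM : M / θ ≤ m := by
    rw [div_le_iff₀ hθ0]
    have e : θ * m = m * θ := mul_comm _ _
    linarith only [hθN, e, hM_def]
  have hmM' : m ≤ M := by
    have : ((N : ℝ) + 1) ≤ (N' : ℝ) + 1 := by exact_mod_cast hNle
    exact this
  have hNN' : N ≤ N' := by omega
  have hsub : cubeEdges (fun _ => -(N : ℤ)) (2 * N + 1) ⊆ cubeEdges (fun _ => -(N' : ℤ)) (2 * N' + 1) :=
    cubeEdges_centred_subset hNN'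
  have hsideN : ((2 * N + 1 : ℕ) : ℝ) * a β ≤ min ℓ₂ ℓ₁ := admissible_of_le haβ hNN' hside
  have hsideℓ₂ : ((2 * N + 1 : ℕ) : ℝ) * a β ≤ ℓ₂ := hsideN.trans (min_le_left _ _)
  have hsideℓ₁ : ((2 * N + 1 : ℕ) : ℝ) * a β ≤ ℓ₁ := hsideN.trans (min_le_right _ _)
  -- key inequalities
  have hRa : R / a β ≤ t * M / θ := by
    have h1 : R / a β ≤ t * d₀ / θ / a β := div_le_div_of_nonneg_right hRle haβ.le
    have h2 : t * d₀ / θ / a β = (t / θ) * (d₀ / a β) := by field_simp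
    rw [h2] at h1
    have h3 : (t / θ) * (d₀ / a β) ≤ (t / θ) * M := mul_le_mul_of_nonneg_left hd₀M (by positivity)
    have h4 : (t / θ) * M = t * M / θ := by ring
    linarith [h1, h3, h4.le, h4.ge]
  have htM1 : 1 ≤ t * M / θ := by
    have h1 : 4 * θ ≤ t * (d₀ / a β) := by
      have h3 := (le_div_iff₀ (by positivity : (0 : ℝ) < 4 * θ)).1
        (show a β ≤ t * d₀ / (4 * θ) from haβt)
      have e : t * (d₀ / a β) = t * d₀ / a β := by ring
      rw [e, le_div_iff₀ haβ]
      linarith only [h3]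
    have h2 : t * (d₀ / a β) ≤ t * M := mul_le_mul_of_nonneg_left hd₀M ht0.le
    rw [le_div_iff₀ hθ0]
    have e2 : t * M / θ * θ = t * M := by field_simp
    linarith only [h1, h2, e2, hθ]
  have hm4 : 4 ≤ m := by
    have h1 : 4 * θ ≤ d₀ / a β := by
      rw [le_div_iff₀ haβ]
      have h5 := (le_div_iff₀ (by positivity : (0 : ℝ) < 4 * θ)).1 haβt
      have h6 := mul_le_mul_of_nonneg_right ht1 hd₀.le
      linarith only [h5, h6, hd₀]
    have h2 : 4 ≤ M / θ := by
      rw [le_div_iff₀ hθ0]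
      have h7 := h1.trans hd₀M
      linarith only [h7]
    exact h2.trans hmM
  have hMθ0 : 0 ≤ M / θ := by positivity
  have hRm : R / a β ≤ m / 2 := by
    have h2 : t * M / θ ≤ m / 2 := by
      have h1 : t * M / θ = t * (M / θ) := by ring
      have h3 := mul_le_mul_of_nonneg_right ht1 hMθ0
      rw [h1]; linarith only [h3, hmM]
    exact hRa.trans h2
  have hRm2 : R / a β + 2 ≤ m := by linarith only [hRm, hm4]
  have hdm : t * d₀ / θ ≤ a β * m := by
    have h1 : t * d₀ / θ ≤ d₀ / θ := by
      apply div_le_div_of_nonneg_right _ hθ0.le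
      have h6 := mul_le_mul_of_nonneg_right ht1 hd₀.le
      linarith only [h6, hd₀]
    have h2 : d₀ / θ ≤ a β * m := by
      rw [div_le_iff₀ hθ0]
      have h3 : d₀ ≤ a β * M := hdd
      have hMm : M ≤ m * θ := by rw [div_le_iff₀ hθ0] at hmM; exact hmM
      have h4 : a β * M ≤ a β * (m * θ) := mul_le_mul_of_nonneg_left hMm haβ.le
      have e : a β * (m * θ) = a β * m * θ := by ring
      linarith only [h3, h4, e]
    exact h1.trans h2
  -- a weighted `w` lies in the `R/aβ`-ball
  have hball : ∀ w : Fin 4 → ℤ, ω w ≠ 0 → ‖siteToE w‖ < R / a β := by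
    intro w hw
    by_contra hge
    have hge' : R / a β ≤ ‖siteToE w‖ := le_of_not_gt hge
    have hR' : R ≤ a β * ‖siteToE w‖ := by
      have h1 := (div_le_iff₀ haβ).1 hge'
      linarith only [h1, mul_comm (a β) ‖siteToE w‖]
    exact hw (hφR _ hR')
  -- FBL in the inner cube `[-N,N]⁴`: at the centre and at the weighted sites
  have hc0 : (fun j => (0 : Fin 4 → ℤ) j - (N : ℤ)) = fun _ => -(N : ℤ) := by funext j; simp
  have hpow : ∀ {d e : ℝ}, 0 < e → e ≤ d → C₁ / d ^ 4 ≤ C₁ / e ^ 4 := fun {d e} he hd =>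
    div_le_div_of_nonneg_left hC₁ (by positivity) (pow_le_pow_left₀ he.le hd 4)
  have hz0 : ∀ ξ : LGConfig 4 G,
      |kerE G r β (fun _ => -(N : ℤ)) (2 * N + 1) ξ (dens G r 0) - p β| ≤ C₁ / (M / θ) ^ 4 := by
    intro ξ
    have hdep : m ≤ (depth (fun _ => -(N : ℤ)) (2 * N + 1) 0 : ℝ) := by
      have := le_depth_centre (0 : Fin 4 → ℤ) N
      rwa [hc0] at this
    have h2 : 2 ≤ depth (fun _ => -(N : ℤ)) (2 * N + 1) 0 := by
      have : (2 : ℝ) ≤ (depth (fun _ => -(N : ℤ)) (2 * N + 1) 0 : ℝ) := by linarith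
      exact_mod_cast this
    exact (hF β hβ₁ _ _ hsideℓ₁ ξ 0 h2).trans (hpow (by positivity) (hmM.trans hdep))
  have hw0 : ∀ w ∈ B, ω w ≠ 0 → ∀ ξ : LGConfig 4 G,
      |kerE G r β (fun _ => -(N : ℤ)) (2 * N + 1) ξ (dens G r (0 + w)) - p β| ≤ C₁ / (M / (2 * θ)) ^ 4 := by
    intro w _ hw0' ξ
    have hwn := (hball w hw0').le
    have h3 : (N : ℝ) + 1 - R / a β ≤ (depth (fun _ => -(N : ℤ)) (2 * N + 1) (0 + w) : ℝ) := by
      have := le_depth_centred_of_norm_le (0 : Fin 4 → ℤ) w N hwn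
      rwa [hc0] at this
    have hdep : M / (2 * θ) ≤ (depth (fun _ => -(N : ℤ)) (2 * N + 1) (0 + w) : ℝ) := by
      have e : M / (2 * θ) = M / θ / 2 := by field_simp
      rw [e]; linarith
    have h2 : 2 ≤ depth (fun _ => -(N : ℤ)) (2 * N + 1) (0 + w) := by
      have : (2 : ℝ) ≤ (depth (fun _ => -(N : ℤ)) (2 * N + 1) (0 + w) : ℝ) := by linarith
      exact_mod_cast this
    exact (hF β hβ₁ _ _ hsideℓ₁ ξ (0 + w) h2).trans (hpow (by positivity) hdep)
  -- law of total covariance through `[-N,N]⁴`, for each of the two exteriors (reference values `0`)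
  have hA := abs_wsum_kerCov_sub_kerE_le G r β hsub η 0 B ω (fun _ => 0) hz0 hw0
  have hA' := abs_wsum_kerCov_sub_kerE_le G r β hsub η' 0 B ω (fun _ => 0) hz0 hw0
  simp only [zero_add, sub_zero] at hA hA'
  -- the inner oscillation
  set G₂ : LGConfig 4 G → ℝ := fun ξ => ∑ w ∈ B, ω w *
    kerCov G r β (fun _ => -(N : ℤ)) (2 * N + 1) ξ (dens G r w) (dens G r 0) with hG₂_def
  have hoscN : ∀ ξ₁ ξ₂ : LGConfig 4 G, |G₂ ξ₁ - G₂ ξ₂| ≤ κ / (4 * θ ^ 4) / m ^ 4 := by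
    intro ξ₁ ξ₂
    have e : G₂ ξ₁ - G₂ ξ₂ = ∑ w ∈ B, ω w *
        (kerCov G r β (fun _ => -(N : ℤ)) (2 * N + 1) ξ₁ (dens G r w) (dens G r 0) -
          kerCov G r β (fun _ => -(N : ℤ)) (2 * N + 1) ξ₂ (dens G r w) (dens G r 0)) := by
      rw [hG₂_def, ← Finset.sum_sub_distrib]
      exact Finset.sum_congr rfl fun w _ => by ring
    rw [e]
    exact HR β hβ₂ N hNS hsideℓ₂ hRm2 hdm ξ₁ ξ₂ B hB φ hφ1 hφR
  have hG₂c : Continuous G₂ :=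
    continuous_finsetSum B fun w _ => continuous_const.mul (continuous_kerCov_dens G r β _ _ w 0)
  set ξ₀ : LGConfig 4 G := fun _ => 1 with hξ₀_def
  have hE : |kerE G r β (fun _ => -(N' : ℤ)) (2 * N' + 1) η G₂ - G₂ ξ₀| ≤ κ / (4 * θ ^ 4) / m ^ 4 :=
    abs_kerE_sub_le_of_forall G r β _ _ η hG₂c fun ξ => hoscN _ _
  have hE' : |kerE G r β (fun _ => -(N' : ℤ)) (2 * N' + 1) η' G₂ - G₂ ξ₀| ≤ κ / (4 * θ ^ 4) / m ^ 4 :=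
    abs_kerE_sub_le_of_forall G r β _ _ η' hG₂c fun ξ => hoscN _ _
  -- the remainder and the oscillation in terms of `M`
  have hWsum : ∑ w ∈ B, |ω w| ≤ (2 * (R / a β) + 1) ^ 4 := sum_abs_weight_le B haβ hR0.le φ hφ1 hφR
  have hX0 : (0 : ℝ) ≤ 2 * (R / a β) + 1 := by positivity
  have hX : 2 * (R / a β) + 1 ≤ 3 * t * M / θ := by
    have e : 3 * t * M / θ = 2 * (t * M / θ) + t * M / θ := by ring
    rw [e]; linarith only [hRa, htM1]
  have hoscM : κ / (4 * θ ^ 4) / m ^ 4 ≤ κ / (4 * θ ^ 4) / (M / θ) ^ 4 :=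
    div_le_div_of_nonneg_left (by positivity) (by positivity) (pow_le_pow_left₀ (by positivity) hmM 4)
  have hbook := cover_bookkeeping (C₁ := C₁) hκ hθ ht0 ht1 htκ hM0 hX0 hX
  have hnn : 0 ≤ 4 * (C₁ / (M / (2 * θ)) ^ 4) * (C₁ / (M / θ) ^ 4) := by positivity
  have hremA : (∑ w ∈ B, |ω w|) * (4 * (C₁ / (M / (2 * θ)) ^ 4) * (C₁ / (M / θ) ^ 4)) ≤
      (2 * (R / a β) + 1) ^ 4 * (4 * (C₁ / (M / (2 * θ)) ^ 4) * (C₁ / (M / θ) ^ 4)) :=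
    mul_le_mul_of_nonneg_right hWsum hnn
  -- assemble: `S_η − S_η' = (S_η − E_η G₂) + (E_η G₂ − G₂ ξ₀) − (E_η' G₂ − G₂ ξ₀) − (S_η' − E_η' G₂)`
  rw [hG₂_def] at hE hE'
  have e : ∑ w ∈ B, ω w * (kerCov G r β (fun _ => -(N' : ℤ)) (2 * N' + 1) η (dens G r w) (dens G r 0) -
        kerCov G r β (fun _ => -(N' : ℤ)) (2 * N' + 1) η' (dens G r w) (dens G r 0)) =
      ∑ w ∈ B, ω w * kerCov G r β (fun _ => -(N' : ℤ)) (2 * N' + 1) η (dens G r w) (dens G r 0) -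
        ∑ w ∈ B, ω w * kerCov G r β (fun _ => -(N' : ℤ)) (2 * N' + 1) η' (dens G r w) (dens G r 0) := by
    rw [← Finset.sum_sub_distrib]
    exact Finset.sum_congr rfl fun w _ => by ring
  show |∑ w ∈ B, ω w * (kerCov G r β (fun _ => -(N' : ℤ)) (2 * N' + 1) η (dens G r w) (dens G r 0) -
        kerCov G r β (fun _ => -(N' : ℤ)) (2 * N' + 1) η' (dens G r w) (dens G r 0))| ≤ κ / M ^ 4
  rw [e]
  have habs := fun (x y : ℝ) => abs_sub x y
  calc |∑ w ∈ B, ω w * kerCov G r β (fun _ => -(N' : ℤ)) (2 * N' + 1) η (dens G r w) (dens G r 0) -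
          ∑ w ∈ B, ω w * kerCov G r β (fun _ => -(N' : ℤ)) (2 * N' + 1) η' (dens G r w) (dens G r 0)|
      ≤ |∑ w ∈ B, ω w * kerCov G r β (fun _ => -(N' : ℤ)) (2 * N' + 1) η (dens G r w) (dens G r 0) -
            kerE G r β (fun _ => -(N' : ℤ)) (2 * N' + 1) η (fun ξ => ∑ w ∈ B, ω w *
              kerCov G r β (fun _ => -(N : ℤ)) (2 * N + 1) ξ (dens G r w) (dens G r 0))|
        + |kerE G r β (fun _ => -(N' : ℤ)) (2 * N' + 1) η (fun ξ => ∑ w ∈ B, ω w *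
              kerCov G r β (fun _ => -(N : ℤ)) (2 * N + 1) ξ (dens G r w) (dens G r 0)) - G₂ ξ₀|
        + |kerE G r β (fun _ => -(N' : ℤ)) (2 * N' + 1) η' (fun ξ => ∑ w ∈ B, ω w *
              kerCov G r β (fun _ => -(N : ℤ)) (2 * N + 1) ξ (dens G r w) (dens G r 0)) - G₂ ξ₀|
        + |∑ w ∈ B, ω w * kerCov G r β (fun _ => -(N' : ℤ)) (2 * N' + 1) η' (dens G r w) (dens G r 0) -
            kerE G r β (fun _ => -(N' : ℤ)) (2 * N' + 1) η' (fun ξ => ∑ w ∈ B, ω w *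
              kerCov G r β (fun _ => -(N : ℤ)) (2 * N + 1) ξ (dens G r w) (dens G r 0))| := by
          set Sη := ∑ w ∈ B, ω w * kerCov G r β (fun _ => -(N' : ℤ)) (2 * N' + 1) η (dens G r w) (dens G r 0)
          set Sη' := ∑ w ∈ B, ω w * kerCov G r β (fun _ => -(N' : ℤ)) (2 * N' + 1) η' (dens G r w) (dens G r 0)
          set Eη := kerE G r β (fun _ => -(N' : ℤ)) (2 * N' + 1) η (fun ξ => ∑ w ∈ B, ω w *
              kerCov G r β (fun _ => -(N : ℤ)) (2 * N + 1) ξ (dens G r w) (dens G r 0))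
          set Eη' := kerE G r β (fun _ => -(N' : ℤ)) (2 * N' + 1) η' (fun ξ => ∑ w ∈ B, ω w *
              kerCov G r β (fun _ => -(N : ℤ)) (2 * N + 1) ξ (dens G r w) (dens G r 0))
          have hdecomp : Sη - Sη' = (Sη - Eη) + (Eη - G₂ ξ₀) - (Eη' - G₂ ξ₀) - (Sη' - Eη') := by ring
          rw [hdecomp]
          have h1 := abs_sub (Sη - Eη + (Eη - G₂ ξ₀) - (Eη' - G₂ ξ₀)) (Sη' - Eη')
          have h2 := abs_sub (Sη - Eη + (Eη - G₂ ξ₀)) (Eη' - G₂ ξ₀)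
          have h3 := abs_add_le (Sη - Eη) (Eη - G₂ ξ₀)
          linarith
    _ ≤ (2 * (R / a β) + 1) ^ 4 * (4 * (C₁ / (M / (2 * θ)) ^ 4) * (C₁ / (M / θ) ^ 4))
        + κ / (4 * θ ^ 4) / (M / θ) ^ 4 + κ / (4 * θ ^ 4) / (M / θ) ^ 4
        + (2 * (R / a β) + 1) ^ 4 * (4 * (C₁ / (M / (2 * θ)) ^ 4) * (C₁ / (M / θ) ^ 4)) := by
          gcongr
          · exact hA.trans hremA
          · exact hE.trans hoscM
          · exact hE'.trans hoscM
          · exact hA'.trans hremA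
    _ = 2 * ((2 * (R / a β) + 1) ^ 4 * (4 * (C₁ / (M / (2 * θ)) ^ 4) * (C₁ / (M / θ) ^ 4)))
        + 2 * (κ / (4 * θ ^ 4) / (M / θ) ^ 4) := by ring
    _ ≤ κ / M ^ 4 := hbook

/-- **`SymNearCovLaw` from `FBL` and the oscillation law on a covering set of radii** (`centredOscLaw_of_cover` then
`symNearCovLaw_of_centredOsc`, whose hypothesis is `CentredOscLaw` unfolded). [folklore] -/
theorem symNearCovLaw_of_centredOsc_cover (a : ℝ → ℝ) (ha : ∀ β, 0 < a β) (hlim : Tendsto a atTop (𝓝 0))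
    (hFBL : FBL G r a) (S : Set ℕ) (θ : ℝ) (hθ : 1 ≤ θ) (D₀ : ℕ)
    (hcover : ∀ D : ℕ, D₀ ≤ D → ∃ N ∈ S, N + 1 ≤ D ∧ (D : ℝ) ≤ θ * ((N : ℝ) + 1))
    (hosc : ∃ ℓ₂ : ℝ, 0 < ℓ₂ ∧ ∀ κ : ℝ, 0 < κ → ∀ d₀ : ℝ, 0 < d₀ → d₀ ≤ ℓ₂ →
      ∃ R : ℝ, 0 < R ∧ R ≤ d₀ ∧ ∃ β₂ : ℝ, ∀ β : ℝ, β₂ ≤ β → ∀ N ∈ S, ((2 * N + 1 : ℕ) : ℝ) * a β ≤ ℓ₂ →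
        R / a β + 2 ≤ (N : ℝ) + 1 → d₀ ≤ a β * ((N : ℝ) + 1) →
        ∀ (η η' : LGConfig 4 G) (B : Finset (Fin 4 → ℤ)),
          (∀ w : Fin 4 → ℤ, a β * ‖siteToE w‖ < R → w ∈ B) →
          ∀ φ : ℝ → ℝ, (∀ t, |φ t| ≤ 1) → (∀ t, R ≤ t → φ t = 0) →
            |∑ w ∈ B, φ (a β * ‖siteToE w‖) *
                (kerCov G r β (fun _ => -(N : ℤ)) (2 * N + 1) η (dens G r w) (dens G r 0) -
                  kerCov G r β (fun _ => -(N : ℤ)) (2 * N + 1) η' (dens G r w) (dens G r 0))| ≤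
              κ / ((N : ℝ) + 1) ^ 4) :
    SymNearCovLaw G r a :=
  symNearCovLaw_of_centredOsc G r a ha hlim hFBL (centredOscLaw_of_cover G r a ha hlim hFBL S θ hθ D₀ hcover hosc)

end Cover

end Summit.QuantumFields.YangMills.Cruxes.ResponseLocalisation.CentredOsc

end
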